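import Literature.AnabelianGeometry.EtaleTheta.ThetaCoversMonodromyModelDefs
import Literature.AnabelianGeometry.EtaleTheta.ThetaCoversTempered
import HarnessLib

/-!
# The MONODROMY MODEL of the tempered theta-covering interface ([EtTh] §2), part 2: the Def. 2.1 / 2.3 data
# `Π_{C̲}`, `ι`, `E`, `S`, `Π_{C̲̲}` over `Π_C = (TG l)^∧` (`Π_{C̲̲}` is of type `(1, l-torsΘ)±`)

S. Mochizuki, *The étale theta function and its Frobenioid-theoretic manifestations* [EtTh], Publ. RIMS **45**
(2009), §2: Def. 2.1 – Prop. 2.2 (PDF pp. 35–38), Def. 2.3 (p. 38), Def. 2.5 (pp. 39–40)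
[cite: MochizukiEtTh2009, Def 2.3 p.38] [cite: MochizukiEtTh2009, Def 2.5 p.39].  Cell abc-iut, layer L2, seat
abc-iut-w6-d084 (gen 7), «P26-NV MONODROMY TOY» STAGE 1 FILE 2a (abc-iut-L2-lead R1352 GO STAGED).  Sequel of
`ThetaCoversMonodromyModelDefs.lean` (part 1: `TG l = ((ℤ/l × ℤ/l) ⋊ D_∞) × ℤ/2`, `Π_C := (TG l)^∧`,
`Φ : Π_C ↠ heisPiC l`, `coverDataAx l hl`).  DEF-BEARING (class (b) MODEL/CONSTRUCTION; no frozen structure touched).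

HONEST LABEL (R1352): a DESIGNED tempered toy with print's monodromy combinatorics — loop ↦ `Δ̄^ell` (`b`-cycle), the
inversion INVERTS it, unipotent monodromy `x ↦ x·z` on the `a`-cycle, `z` = cusp inertia = `Δ̄_Θ` central;
`G_K := 1`; NOT a Tate curve, NOT the tempered fundamental group of a curve; consistency ≠ faithfulness; nothing here
takes a side on anything printed.

CONTENT.  §1 Three coordinate subgroups of abc-iut-w5-d243's `heisPiC l = (ℤ/l × ℤ/l) ⋊ D_l` (coordinates `b = β`,
`c = γ`, and the `D_l`-component): `heisB0 = {β = 0}` (the shadow of `Π_{C̲}`), `heisD = {β = γ = 0} = D_l` (the shadow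
of `Π_{C̲̲}`), and the character `betaChar : heisPiX → ℤ/l` (so `Π_{X̲} = Φ⁻¹{β = 0, rotation}`: the covering
`X̲ → X` kills the `a`-cycle `b ↦ 0`, NOT the loop).  §2 The Def. 2.3 data over `Π_C = (TG l)^∧`:
`Π_{C̲} := Φ⁻¹(heisB0)` is of type `(1, l-tors)±`, `ι := η(s)` is an inversion with `ι² = 1`,
`E := Φ⁻¹(heisD ∩ heisPiX) = Φ⁻¹⟨r⟩` is the `(−1)`-eigenspace datum, `S := Ker Φ` a splitting (`G_K = 1`), hence
`Π_{C̲̲} := (S ⊔ E) ⊔ ⟨ι⟩` is of type `(1, l-torsΘ)±` (`isTypeLTorsThetaPm_PiCuuM`).  Sequel FILE 2b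
(`ThetaCoversMonodromyModelTempered.lean`): the tempered layer of Def. 2.5 and `monodromyModel l hl : TemperedCoverData l`.
-/

noncomputable section

namespace Literature.AnabelianGeometry.EtaleTheta.ThetaCovers.MonodromyModel

open Multiplicative HeisenbergWitness TemperedModel Literature.AnabelianGeometry.SemiGraphs

variable (l : ℕ)

/-! ## 1. Coordinate subgroups of the finite Heisenberg witness -/

/-- `heisB0 := {β = 0} ⊆ heisPiC l` — the shadow of `Π_{C̲}` (`b ↦ 0`; closed under multiplication by the cocycle
rule `β(xy) = β(x) + ε(x) β(y)`). (toy bookkeeping for the typed interface of [EtTh] Def. 2.1; no claim about print)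
[cite: MochizukiEtTh2009, Def 2.1 p.36] -/
def heisB0 : Subgroup (heisPiC l) where
  carrier := {x | β l x = 0}
  mul_mem' {x y} hx hy := by
    simp only [Set.mem_setOf_eq] at hx hy ⊢
    rw [β_mul, hx, hy, mul_zero, add_zero]
  one_mem' := by simp
  inv_mem' {x} hx := by
    simp only [Set.mem_setOf_eq] at hx ⊢
    rw [β_inv, hx, mul_zero, neg_zero]

/-- Membership in `heisB0`. (toy bookkeeping) [cite: MochizukiEtTh2009, Def 2.1 p.36] -/
theorem mem_heisB0 {x : heisPiC l} : x ∈ heisB0 l ↔ β l x = 0 := Iff.rfl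

/-- `heisD := {β = γ = 0} = D_l ⊆ heisPiC l` — the shadow of `Π_{C̲̲}`. (toy bookkeeping for the typed interface of
[EtTh] Def. 2.3; no claim about print) [cite: MochizukiEtTh2009, Def 2.3 p.38] -/
def heisD : Subgroup (heisPiC l) where
  carrier := {x | x.left = 1}
  mul_mem' {x y} hx hy := by
    simp only [Set.mem_setOf_eq] at hx hy ⊢
    rw [SemidirectProduct.mul_left, hx, hy, map_one, mul_one]
  one_mem' := rfl
  inv_mem' {x} hx := by
    simp only [Set.mem_setOf_eq] at hx ⊢
    rw [SemidirectProduct.inv_left, hx, inv_one, map_one]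

/-- Membership in `heisD`. (toy bookkeeping; no claim about print) [cite: MochizukiEtTh2009, Def 2.3 p.38] -/
theorem mem_heisD {x : heisPiC l} : x ∈ heisD l ↔ x.left = 1 := Iff.rfl

/-- Membership in `heisD` by coordinates. (toy bookkeeping) [cite: MochizukiEtTh2009, Def 2.3 p.38] -/
theorem mem_heisD_iff {x : heisPiC l} : x ∈ heisD l ↔ β l x = 0 ∧ γ l x = 0 := by
  rw [mem_heisD]
  constructor
  · intro h
    exact ⟨by simp [β, h], by simp [γ, h]⟩
  · rintro ⟨h1, h2⟩
    apply toAdd.injective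
    exact Prod.ext h1 h2

/-- `heisD ≤ heisB0`. (toy bookkeeping) [cite: MochizukiEtTh2009, Def 2.3 p.38] -/
theorem heisD_le_heisB0 : heisD l ≤ heisB0 l := fun _ hx => ((mem_heisD_iff l).mp hx).1

/-- `inr g ∈ heisD`. (toy bookkeeping; no claim about print) [cite: MochizukiEtTh2009, Def 2.3 p.38] -/
theorem inr_mem_heisD (g : DihedralGroup l) : (SemidirectProduct.inr g : heisPiC l) ∈ heisD l := rfl

/-- `heisTheta ≤ heisB0`. (toy bookkeeping; no claim about print) [cite: MochizukiEtTh2009, Def 2.1 p.36] -/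
theorem heisTheta_le_heisB0 : heisTheta l ≤ heisB0 l := fun _ hx => ((mem_heisTheta l).mp hx).2

/-- The reflection `s` is not in `heisPiX`. (toy bookkeeping) [cite: MochizukiEtTh2009, Prop 2.2 p.37] -/
theorem inr_sr_not_mem_heisPiX (i : ZMod l) : (SemidirectProduct.inr (DihedralGroup.sr i) : heisPiC l) ∉ heisPiX l := by
  rw [mem_heisPiX]
  rintro ⟨j, hj⟩
  cases hj

/-- `[heisB0 : heisB0 ∩ heisPiX] = 2`. (toy bookkeeping; no claim about print) [cite: MochizukiEtTh2009, Def 2.1 p.36] -/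
theorem relIndex_heisB0_inf : (heisB0 l ⊓ heisPiX l).relIndex (heisB0 l) = 2 := by
  haveI : (heisPiX l).Normal := MonoidHom.normal_ker _
  rw [Subgroup.inf_relIndex_left]
  have hdvd : (heisPiX l).relIndex (heisB0 l) ∣ 2 := index_heisPiX l ▸ Subgroup.relIndex_dvd_index_of_normal _ _
  rcases (Nat.dvd_prime Nat.prime_two).mp hdvd with h1 | h2
  · exfalso
    rw [Subgroup.relIndex_eq_one] at h1
    exact inr_sr_not_mem_heisPiX l 0 (h1 ((heisD_le_heisB0 l) (inr_mem_heisD l _)))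
  · exact h2

/-- The character `β : heisPiX → ℤ/l` (additive where `ε = 1`); its kernel is the shadow of `Π_{X̲}` (the covering
`X̲ → X` of the model kills the `a`-cycle). (toy bookkeeping for [EtTh] Def. 2.1 «`Π̄^ell_X ↠ Q`»; no claim about print)
[cite: MochizukiEtTh2009, Def 2.1 p.36] -/
def betaChar : ↥(heisPiX l) →* Multiplicative (ZMod l) where
  toFun x := ofAdd (β l x)
  map_one' := by simp
  map_mul' x y := by
    obtain ⟨i, hi⟩ := (mem_heisPiX l).mp x.2
    apply toAdd.injective
    simp [hi]

/-- `betaChar x = ofAdd (β x)`. (toy bookkeeping; no claim about print) [cite: MochizukiEtTh2009, Def 2.1 p.36] -/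
@[simp] theorem betaChar_apply (x : ↥(heisPiX l)) : betaChar l x = ofAdd (β l (x : heisPiC l)) := rfl

/-- `betaChar` is surjective (`(b, 0) ↦ b`). (toy bookkeeping; no claim about print) [cite: MochizukiEtTh2009, Def 2.1 p.36] -/
theorem betaChar_surjective : Function.Surjective (betaChar l) := by
  intro b
  refine ⟨⟨SemidirectProduct.inl (ofAdd (toAdd b, 0)), (mem_heisPiX l).mpr ⟨0, ?_⟩⟩, ?_⟩
  · rw [SemidirectProduct.right_inl, DihedralGroup.one_def]
  · apply toAdd.injective
    simp

/-- `(heisD ∩ heisPiX) ∩ heisTheta = 1`. (toy bookkeeping) [cite: MochizukiEtTh2009, Prop 2.2 p.37] -/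
theorem heisD_inf_heisPiX_inf_heisTheta : (heisD l ⊓ heisPiX l) ⊓ heisTheta l = ⊥ := by
  rw [eq_bot_iff]
  rintro x ⟨⟨hD, -⟩, hT⟩
  rw [Subgroup.mem_bot]
  exact SemidirectProduct.ext hD ((mem_heisTheta l).mp hT).1

/-- `(heisD ∩ heisPiX) · heisTheta = heisB0 ∩ heisPiX`. (toy bookkeeping) [cite: MochizukiEtTh2009, Prop 2.2 p.37] -/
theorem heisD_inf_heisPiX_sup_heisTheta : (heisD l ⊓ heisPiX l) ⊔ heisTheta l = heisB0 l ⊓ heisPiX l := by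
  haveI := heisTheta_normal l
  refine le_antisymm (sup_le (inf_le_inf_right _ (heisD_le_heisB0 l))
    (le_inf (heisTheta_le_heisB0 l) (heisTheta_le_heisPiX l))) ?_
  rintro x ⟨hB, hX⟩
  obtain ⟨i, hi⟩ := (mem_heisPiX l).mp hX
  rw [Subgroup.mem_sup_of_normal_right]
  refine ⟨SemidirectProduct.inr (DihedralGroup.r i), ⟨inr_mem_heisD l _, (mem_heisPiX l).mpr ⟨i, rfl⟩⟩,
    (SemidirectProduct.inr (DihedralGroup.r i))⁻¹ * x, ?_, mul_inv_cancel_left _ _⟩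
  refine (mem_heisTheta l).mpr ⟨?_, ?_⟩
  · rw [SemidirectProduct.mul_right, SemidirectProduct.inv_right, SemidirectProduct.right_inr, hi, inv_mul_cancel]
  · rw [β_mul, β_inv, β_inr, (mem_heisB0 l).mp hB]
    simp

/-- `heisB0 ∩ heisPiX` normalises `heisD ∩ heisPiX`. (toy bookkeeping) [cite: MochizukiEtTh2009, Prop 2.2 p.37] -/
theorem conj_mem_heisD_inf {g e : heisPiC l} (hg : g ∈ heisB0 l ⊓ heisPiX l) (he : e ∈ heisD l ⊓ heisPiX l) :
    g * e * g⁻¹ ∈ heisD l ⊓ heisPiX l := by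
  haveI : (heisPiX l).Normal := MonoidHom.normal_ker _
  have hgB : β l g = 0 := (mem_heisB0 l).mp hg.1
  have hgX : g ∈ heisPiX l := hg.2
  have heD : β l e = 0 ∧ γ l e = 0 := (mem_heisD_iff l).mp he.1
  have heX : e ∈ heisPiX l := he.2
  obtain ⟨i, hi⟩ := (mem_heisPiX l).mp hgX
  obtain ⟨j, hj⟩ := (mem_heisPiX l).mp heX
  refine ⟨(mem_heisD_iff l).mpr ⟨?_, ?_⟩, ?_⟩
  · simp [hgB, heD.1, hi, hj]
  · simp [hgB, heD.1, heD.2, hi, hj]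
  · exact Subgroup.mul_mem _ (Subgroup.mul_mem _ hgX heX) (Subgroup.inv_mem _ hgX)

/-- `s` normalises `heisD ∩ heisPiX` (`s r^j s = r^{-j}`). (toy bookkeeping) [cite: MochizukiEtTh2009, Prop 2.2 p.37] -/
theorem sr_conj_mem_heisD_inf {e : heisPiC l} (he : e ∈ heisD l ⊓ heisPiX l) :
    SemidirectProduct.inr (DihedralGroup.sr 0) * e * (SemidirectProduct.inr (DihedralGroup.sr 0))⁻¹ ∈
      heisD l ⊓ heisPiX l := by
  obtain ⟨heD, heX⟩ := he
  obtain ⟨j, hj⟩ := (mem_heisPiX l).mp heX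
  have he' : e = SemidirectProduct.inr (DihedralGroup.r j) := SemidirectProduct.ext heD (by simpa using hj)
  subst he'
  rw [← map_inv, ← map_mul, ← map_mul, DihedralGroup.inv_sr, DihedralGroup.sr_mul_r, DihedralGroup.sr_mul_sr]
  exact ⟨inr_mem_heisD l _, (mem_heisPiX l).mpr ⟨_, rfl⟩⟩

/-- `s r^j s⁻¹ r^j = 1` for `r^j ∈ heisD ∩ heisPiX`. (toy bookkeeping) [cite: MochizukiEtTh2009, Prop 2.2 p.37] -/
theorem sr_conj_mul_self_eq_one {e : heisPiC l} (he : e ∈ heisD l ⊓ heisPiX l) :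
    SemidirectProduct.inr (DihedralGroup.sr 0) * e * (SemidirectProduct.inr (DihedralGroup.sr 0))⁻¹ * e = 1 := by
  obtain ⟨heD, heX⟩ := he
  obtain ⟨j, hj⟩ := (mem_heisPiX l).mp heX
  have he' : e = SemidirectProduct.inr (DihedralGroup.r j) := SemidirectProduct.ext heD (by simpa using hj)
  subst he'
  rw [← map_inv, ← map_mul, ← map_mul, ← map_mul, DihedralGroup.inv_sr, DihedralGroup.sr_mul_r,
    DihedralGroup.sr_mul_sr, DihedralGroup.r_mul_r, show (0 - (0 + j) + j : ZMod l) = 0 by ring,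
    ← DihedralGroup.one_def, map_one]

/-- `s` centralises `heisTheta` (`s · (0, c) = (0, c)`). (toy bookkeeping) [cite: MochizukiEtTh2009, Prop 2.2 p.37] -/
theorem sr_conj_theta_eq {t : heisPiC l} (ht : t ∈ heisTheta l) :
    SemidirectProduct.inr (DihedralGroup.sr 0) * t * (SemidirectProduct.inr (DihedralGroup.sr 0))⁻¹ * t⁻¹ = 1 := by
  obtain ⟨ht1, ht2⟩ := (mem_heisTheta l).mp ht
  refine eq_one_of_coords l ?_ ?_ ?_
  · simp [ht1]
  · simp [ht1, ht2]
  · simp [ht1, ht2]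

/-! ## 2. The Def. 2.1 / 2.3 data over `Π_C = (TG l)^∧` -/

section Profinite

variable [NeZero l]

/-- **The model's `CoverDataAx`, η-expanded in coordinates** (REDUCIBLE twin of part 1's `coverDataAx l hl`, to which
it is definitionally equal, `coverDataAx'_eq`): every data field is spelled out over `Π_C = (TG l)^∧`
(`Π_X = Φ⁻¹(heisPiX)`, `Ker(Δ_X ↠ Δ̄_X) = Φ⁻¹(1)`, `Δ̄_Θ`-preimage `= D_x = Φ⁻¹(heisTheta)`, `G_K = 1`), every proof
field is the corresponding field of `coverDataAx l hl`; downstream files see the coordinates by unfolding.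
(toy bookkeeping for the typed interface of [EtTh] Def. 2.1; no claim about print) [cite: MochizukiEtTh2009, Def 2.1 p.36] -/
@[reducible] def coverDataAx' (hl : Odd l) : CoverDataAx.{0} l where
  l_odd := hl
  PiC := PiC l
  grp := inferInstance
  top := inferInstance
  tg := inferInstance
  GK := PUnit.{1}
  grpGK := inferInstance
  aug := (1 : heisPiC l →* PUnit.{1}).comp (Phi l)
  PiX := (heisPiX l).comap (Phi l)
  PiX_normal := (coverDataAx l hl).PiX_normal
  index_PiX := (coverDataAx l hl).index_PiX
  isOpen_PiX := (coverDataAx l hl).isOpen_PiX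
  aug_PiX_surjective := (coverDataAx l hl).aug_PiX_surjective
  barKer := (⊥ : Subgroup (heisPiC l)).comap (Phi l)
  barKer_normal := (coverDataAx l hl).barKer_normal
  isClosed_barKer := (coverDataAx l hl).isClosed_barKer
  barTheta := (heisTheta l).comap (Phi l)
  barTheta_normal := (coverDataAx l hl).barTheta_normal
  barKer_le_barTheta := (coverDataAx l hl).barKer_le_barTheta
  barTheta_le := (coverDataAx l hl).barTheta_le
  relIndex_barKer := (coverDataAx l hl).relIndex_barKer
  ell_rank_two := (coverDataAx l hl).ell_rank_two
  barTheta_central := (coverDataAx l hl).barTheta_central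
  Dx := (heisTheta l).comap (Phi l)
  Dx_le := (coverDataAx l hl).Dx_le
  aug_Dx_surjective := (coverDataAx l hl).aug_Dx_surjective
  inertia_sup_barKer := (coverDataAx l hl).inertia_sup_barKer
  pow_mem_barKer := (coverDataAx l hl).pow_mem_barKer
  inv_ell := (coverDataAx l hl).inv_ell
  inv_theta := (coverDataAx l hl).inv_theta

/-- The η-expanded twin IS part 1's `coverDataAx l hl`, definitionally. (toy bookkeeping) [cite: MochizukiEtTh2009, Def 2.1 p.36] -/
theorem coverDataAx'_eq (hl : Odd l) : coverDataAx' l hl = coverDataAx l hl := rfl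


/-- **`Π_{C̲} := Φ⁻¹(heisB0)`** (the covering `X̲ → X` of the model kills the `a`-cycle: `Π_{X̲} = Φ⁻¹{β = 0, rotation}`).
(toy bookkeeping for the typed interface of [EtTh] Def. 2.1; no claim about print) [cite: MochizukiEtTh2009, Def 2.1 p.36] -/
def PiCuM : Subgroup (PiC l) := (heisB0 l).comap (Phi l)

/-- **`E := Φ⁻¹(heisD ∩ heisPiX) = Φ⁻¹⟨r⟩`**, the `(−1)`-eigenspace datum `Im(s_ι)` of Prop. 2.2 (i) at the model (the
inversion inverts the loop). (toy bookkeeping; no claim about print) [cite: MochizukiEtTh2009, Prop 2.2 p.37] -/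
def EM : Subgroup (PiC l) := (heisD l ⊓ heisPiX l).comap (Phi l)

/-- The reflection `s = sr 0 ∈ D_∞` as an element of `Π^tp_C = TG l`. (toy bookkeeping) [cite: MochizukiEtTh2009, Prop 2.2 p.37] -/
def iotaT : TG l := ((SemidirectProduct.inr (DihedralGroup.sr 0) : TG₀ l), (1 : Multiplicative (ZMod 2)))

/-- **`ι := η(s) ∈ Π_C`**, the inversion of the model. (toy bookkeeping) [cite: MochizukiEtTh2009, Prop 2.2 p.37] -/
def iotaM : PiC l := toHat l (iotaT l)

/-- **`Π_{C̲̲} := (Ker(Δ_X ↠ Δ̄_X) ⊔ E) ⊔ ⟨ι⟩`** (Def. 2.3 with the splitting `S := Ker Φ`, `G_K = 1`).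
(toy bookkeeping for the typed interface of [EtTh] Def. 2.3; no claim about print) [cite: MochizukiEtTh2009, Def 2.3 p.38] -/
def PiCuuM : Subgroup (PiC l) := ((⊥ : Subgroup (heisPiC l)).comap (Phi l) ⊔ EM l) ⊔ Subgroup.zpowers (iotaM l)

/-- `Φ(ι) = s`. (toy bookkeeping; no claim about print) [cite: MochizukiEtTh2009, Prop 2.2 p.37] -/
@[simp] theorem Phi_iotaM : Phi l (iotaM l) = SemidirectProduct.inr (DihedralGroup.sr 0) := by
  rw [iotaM, Phi_toHat]
  refine SemidirectProduct.ext rfl ?_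
  rw [iotaT, sh₀_right, SemidirectProduct.right_inr, dihedralRed_sr, map_zero, SemidirectProduct.right_inr]

omit [NeZero l] in
/-- `s² = 1` in `TG l`. (toy bookkeeping; no claim about print) [cite: MochizukiEtTh2009, Prop 2.2 p.37] -/
theorem iotaT_mul_self : iotaT l * iotaT l = 1 := by
  refine Prod.ext ?_ rfl
  change SemidirectProduct.inr (DihedralGroup.sr (0 : ZMod 0)) * SemidirectProduct.inr (DihedralGroup.sr 0) =
    (1 : TG₀ l)
  rw [← map_mul, DihedralGroup.sr_mul_self, map_one]

omit [NeZero l] in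
/-- `ι² = 1`. (toy bookkeeping; no claim about print) [cite: MochizukiEtTh2009, Prop 2.2 p.37] -/
theorem iotaM_mul_self : iotaM l * iotaM l = 1 := by
  rw [iotaM, ← map_mul, iotaT_mul_self, map_one]

variable (hl : Odd l)

/-- `Ker(aug) = Π_C` at the model (`G_K = 1`). (toy bookkeeping) [cite: MochizukiEtTh2009, Def 2.1 p.36] -/
theorem aug_ker_eq_top : (coverDataAx' l hl).aug.ker = ⊤ := by
  ext x
  simp only [MonoidHom.mem_ker, Subgroup.mem_top]

/-- `Π_{X̲} := Π_{C̲} ∩ Π_X = Φ⁻¹(heisB0 ∩ heisPiX)` is of type `(1, l-tors)`: the quotient is `β ∘ Φ`.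
(toy bookkeeping for the typed interface of [EtTh] Def. 2.1; no claim about print) [cite: MochizukiEtTh2009, Def 2.1 p.36] -/
theorem isTypeLTors_inf : (coverDataAx' l hl).toCoverData.IsTypeLTors (PiCuM l ⊓ (coverDataAx' l hl).PiX) where
  le := inf_le_right
  quot := by
    refine ⟨(betaChar l).comp ((Phi l).subgroupComap (heisPiX l)),
      (betaChar_surjective l).comp ((Phi l).subgroupComap_surjective_of_surjective _ (Phi_surjective l)),
      fun g => ?_⟩
    change ofAdd (β l (Phi l (g : PiC l))) = 1 ↔ (g : PiC l) ∈ PiCuM l ⊓ (heisPiX l).comap (Phi l)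
    rw [← ofAdd_zero, ofAdd.apply_eq_iff_eq]
    exact ⟨fun h => ⟨h, g.2⟩, fun h => h.1⟩
  barTheta_le := le_inf (Subgroup.comap_mono (heisTheta_le_heisB0 l)) (Subgroup.comap_mono (heisTheta_le_heisPiX l))
  delta_sup := by
    change (PiCuM l ⊓ (coverDataAx' l hl).PiX) ⊔ ((coverDataAx' l hl).PiX ⊓ (coverDataAx' l hl).aug.ker) = _
    rw [aug_ker_eq_top, inf_top_eq]
    exact sup_eq_right.mpr inf_le_right
  Dx_le := le_inf (Subgroup.comap_mono (heisTheta_le_heisB0 l)) (Subgroup.comap_mono (heisTheta_le_heisPiX l))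

/-- `Π_{C̲} = Φ⁻¹(heisB0)` is of type `(1, l-tors)±`. (toy bookkeeping) [cite: MochizukiEtTh2009, Def 2.1 p.36] -/
theorem isTypeLTorsPm_PiCuM : (coverDataAx' l hl).toCoverData.IsTypeLTorsPm (PiCuM l) where
  inf_isTypeLTors := isTypeLTors_inf l hl
  relIndex_two := by
    change ((heisB0 l).comap (Phi l) ⊓ (heisPiX l).comap (Phi l)).relIndex ((heisB0 l).comap (Phi l)) = 2
    rw [← Subgroup.comap_inf, Subgroup.relIndex_comap, Subgroup.map_comap_eq_self_of_surjective (Phi_surjective l),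
      relIndex_heisB0_inf]

/-- `ι = η(s)` is an inversion for `Π_{C̲}`. (toy bookkeeping) [cite: MochizukiEtTh2009, Prop 2.2 p.37] -/
theorem isInversion_iotaM : (coverDataAx' l hl).toCoverData.IsInversion (PiCuM l) (iotaM l) where
  mem := by
    change iotaM l ∈ (heisB0 l).comap (Phi l)
    rw [Subgroup.mem_comap, Phi_iotaM]
    exact heisD_le_heisB0 l (inr_mem_heisD l _)
  mem_delta := by
    change iotaM l ∈ (coverDataAx' l hl).aug.ker
    rw [aug_ker_eq_top]; trivial
  not_mem := by
    change iotaM l ∉ (heisPiX l).comap (Phi l)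
    rw [Subgroup.mem_comap, Phi_iotaM]
    exact inr_sr_not_mem_heisPiX l 0

/-- `E = Φ⁻¹⟨r⟩` is the `(−1)`-eigenspace datum of Prop. 2.2 (i) for `(Π_{X̲}, Π_{C̲}, ι)` at the model.
(toy bookkeeping for the typed interface of [EtTh] Prop. 2.2 (i); no claim about print) [cite: MochizukiEtTh2009, Prop 2.2 p.37] -/
theorem isMinusEigen_EM :
    (coverDataAx' l hl).toCoverData.IsMinusEigen (PiCuM l ⊓ (coverDataAx' l hl).PiX) (PiCuM l) (iotaM l) (EM l) where
  barKer_le := Subgroup.comap_mono bot_le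
  le := by
    change EM l ≤ (PiCuM l ⊓ (heisPiX l).comap (Phi l)) ⊓ (coverDataAx' l hl).aug.ker
    rw [aug_ker_eq_top, inf_top_eq]
    exact le_inf (Subgroup.comap_mono (inf_le_left.trans (heisD_le_heisB0 l))) (Subgroup.comap_mono inf_le_right)
  conj_mem := by
    intro g hg e he
    change g ∈ (heisB0 l).comap (Phi l) ⊓ (heisPiX l).comap (Phi l) at hg
    change Phi l (g * e * g⁻¹) ∈ heisD l ⊓ heisPiX l
    rw [map_mul, map_mul, map_inv]
    exact conj_mem_heisD_inf l hg he
  inf_eq := by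
    change EM l ⊓ (heisTheta l).comap (Phi l) = (⊥ : Subgroup (heisPiC l)).comap (Phi l)
    rw [EM, ← Subgroup.comap_inf, heisD_inf_heisPiX_inf_heisTheta]
  sup_eq := by
    change EM l ⊔ (heisTheta l).comap (Phi l) = (PiCuM l ⊓ (heisPiX l).comap (Phi l)) ⊓ (coverDataAx' l hl).aug.ker
    rw [aug_ker_eq_top, inf_top_eq, EM, PiCuM, Subgroup.comap_sup_eq (Phi l) _ _ (Phi_surjective l),
      heisD_inf_heisPiX_sup_heisTheta, Subgroup.comap_inf]
  minus := by
    intro e he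
    change Phi l (iotaM l * e * (iotaM l)⁻¹ * e) ∈ (⊥ : Subgroup (heisPiC l))
    rw [map_mul, map_mul, map_mul, map_inv, Phi_iotaM, Subgroup.mem_bot]
    exact sr_conj_mul_self_eq_one l he
  plus := by
    intro t ht
    change Phi l (iotaM l * t * (iotaM l)⁻¹ * t⁻¹) ∈ (⊥ : Subgroup (heisPiC l))
    rw [map_mul, map_mul, map_mul, map_inv, map_inv, Phi_iotaM, Subgroup.mem_bot]
    exact sr_conj_theta_eq l ht
  iota_conj := by
    intro e he
    change Phi l (iotaM l * e * (iotaM l)⁻¹) ∈ heisD l ⊓ heisPiX l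
    rw [map_mul, map_mul, map_inv, Phi_iotaM]
    exact sr_conj_mem_heisD_inf l he

/-- `S := Ker Φ` is a splitting of `D̄_x ↠ G_K` (`G_K = 1`). (toy bookkeeping) [cite: MochizukiEtTh2009, Prop 2.2 p.37] -/
theorem isSplitting_barKer : (coverDataAx' l hl).toCoverData.IsSplitting (coverDataAx' l hl).barKer where
  barKer_le := le_rfl
  le := le_sup_right
  inf_eq := inf_eq_left.mpr (coverDataAx' l hl).barKer_le_barTheta
  surj := fun _ => ⟨1, Subsingleton.elim (α := PUnit) _ _⟩

/-- **`Π_{C̲̲} := (Ker Φ ⊔ E) ⊔ ⟨ι⟩` is of type `(1, l-torsΘ)±`** (Def. 2.3) at the model. (toy bookkeeping for the typed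
interface of [EtTh] Def. 2.3; no claim about print) [cite: MochizukiEtTh2009, Def 2.3 p.38] -/
theorem isTypeLTorsThetaPm_PiCuuM : (coverDataAx' l hl).toCoverData.IsTypeLTorsThetaPm (PiCuuM l) :=
  ⟨⟨PiCuM l, EM l, (coverDataAx' l hl).barKer, iotaM l, isTypeLTorsPm_PiCuM l hl, isInversion_iotaM l hl,
    by rw [iotaM_mul_self]; exact Subgroup.one_mem _, isMinusEigen_EM l hl, isSplitting_barKer l hl, rfl⟩⟩

/-- `Ker Φ ≤ Π_{C̲̲}`. (toy bookkeeping) [cite: MochizukiEtTh2009, Def 2.3 p.38] -/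
theorem ker_Phi_le_PiCuuM : (Phi l).ker ≤ PiCuuM l := by
  rw [← MonoidHom.comap_bot]
  exact le_sup_left.trans le_sup_left

/-- `Π_{C̲̲}` is open in `Π_C` (it contains the open `Ker Φ`). (toy bookkeeping) [cite: MochizukiEtTh2009, Def 2.3 p.38] -/
theorem isOpen_PiCuuM : IsOpen (PiCuuM l : Set (PiC l)) := by
  refine Subgroup.isOpen_mono (ker_Phi_le_PiCuuM l) ?_
  have h : ((Phi l).ker : Set (PiC l)) = Phi l ⁻¹' {1} := by
    ext x; simp [MonoidHom.mem_ker]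
  rw [h]
  letI : TopologicalSpace (heisPiC l) := ⊥
  haveI : DiscreteTopology (heisPiC l) := ⟨rfl⟩
  exact (continuous_Phi l ⊥).isOpen_preimage _ (isOpen_discrete _)

end Profinite

end Literature.AnabelianGeometry.EtaleTheta.ThetaCovers.MonodromyModel

end
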